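import Literature.NumberTheory.EllipticCurves.QuadraticTwistAtTwoMinimalModelProofs
import Literature.NumberTheory.QuadraticFields.FundamentalDiscriminant
import HarnessLib

/-!
# Twisting by a field discriminant: two globally minimal curves `W`, `A ≅ W ⊗ χ_{d_K}` are not both
# multiplicative at a prime `ℓ ∣ d_K` — helper of the registered stub `stub_tamagawaParityR0` (S6, G1)
# of line `genus-stringent-road-k` (crux `AdditiveBranchIMC.GordTwoRankZeroOffCaseOne`,
# item stmt-BirchSwinnertonDyer-19357; stub-worker S6 under the LEAD prover g22, wave 1)

HONEST FRAMING. Nothing about the Birch–Swinnerton-Dyer conjecture is proved here and the crux item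
stays OPEN: this file is a HELPER for crux 19357 (it feeds the local Tamagawa parity file
`AdditiveBranchIMCGordTwoRankZeroOffCaseOneTamagawaParityR0.lean`). THEOREMS ONLY, sorry-free, from
tree theorems; no definition, no named fact.

THE LEMMA (`not_hasMultiplicativeReductionAtPrime_of_smul_quadraticTwist_discr`). For `W, A / ℚ`
globally minimal, `K` a quadratic field, `A = C • W^{(d_K)}` and a prime `ℓ ∣ d_K`: if `A` is
multiplicative at `ℓ` then `W` is NOT (twisting a Tate curve by a RAMIFIED quadratic character gives
additive reduction; Silverman *AEC* VII.5 Prop. 5.1 with X.5 Cor. 5.4). The proof is pure arithmetic of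
the covariants and holds ALSO AT `ℓ = 2` (no Tate algorithm): both `c₄` are `ℓ`-units
(`hasMultiplicativeReductionAt_iff_of_isMinimalAt`) and `c₄(A)·u⁴ = d_K²·c₄(W)`, so `ord_ℓ d_K` is
even — impossible for odd `ℓ ∥ d_K` (`Quadratic.not_sq_dvd_discr_of_prime_ne_two`) and for
`d_K = 8m'`; for `d_K = 4m`, `m ≡ 3 (mod 4)` (`Quadratic.discr_div_four_emod_four`) both minimal
equations have `a₁` odd (`odd_a₁_of_hasMultiplicativeReductionAtPrime_two`), hence `c₆ ≡ −1 (mod 4)`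
(`exists_c₆_eq_of_odd_a₁`), and `c₆(A)·u⁶ = d_K³·c₆(W)` with `u = 2w`, `w` a `2`-adic unit, reads
`−1 ≡ −m³ ≡ +1 (mod 4)` — contradiction.

References: [cite: SilvermanAEC2009, VII.5 Prop. 5.1, X.5 Cor. 5.4, III.1 Table 3.1]
[cite: Marcus2018, Ch. 2 Thm. 1 (field discriminant of a quadratic field)].
Axioms: `propext`, `Classical.choice`, `Quot.sound`.
-/

set_option autoImplicit false
-- D-0017: single-problem summit, so `Summit.BirchSwinnertonDyer.BirchSwinnertonDyer.…` repeats a namespace BY DESIGN.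
set_option linter.dupNamespace false

noncomputable section

open scoped Classical

namespace Summit.BirchSwinnertonDyer.BirchSwinnertonDyer.Theorems.GenusStringentRoadK

open WeierstrassCurve NumberField IsDedekindDomain Rat.HeightOneSpectrum
open Literature.NumberTheory.EllipticCurves

/-! ### §1 Elementary arithmetic -/

/-- An integer not divisible by `2` is odd. [folklore] -/
private theorem odd_of_not_two_dvd {n : ℤ} (h : ¬ (2 : ℤ) ∣ n) : Odd n := by
  rcases Int.even_or_odd n with he | ho
  · exact absurd (even_iff_two_dvd.mp he) h
  · exact ho

/-- Mod-`4` core of the `2`-adic case: for odd `a, b` and `cA6 ≡ c6 ≡ m ≡ 3 (mod 4)` one has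
`cA6 · a⁶ ≢ m³ · c6 · b⁶ (mod 4)` (`3 ≢ 27 · 3 ≡ 1`). [folklore] -/
private theorem int_mod_four_core {cA6 c6 a b m : ℤ} (ha : a % 2 = 1) (hb : b % 2 = 1)
    (hcA6 : cA6 % 4 = 3) (hc6 : c6 % 4 = 3) (hm : m % 4 = 3) :
    cA6 * a ^ 6 ≠ m ^ 3 * c6 * b ^ 6 := by
  intro h
  have key : ∀ x y : ZMod 4, (x = 1 ∨ x = 3) → (y = 1 ∨ y = 3) →
      (3 : ZMod 4) * x ^ 6 ≠ 3 ^ 3 * 3 * y ^ 6 := by decide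
  have cast : ∀ {z r : ℤ}, z % 4 = r → (z : ZMod 4) = (r : ZMod 4) := fun {z r} hz ↦
    (ZMod.intCast_eq_intCast_iff' z r 4).mpr (by push_cast; omega)
  have hx : (a : ZMod 4) = 1 ∨ (a : ZMod 4) = 3 := by
    rcases (show a % 4 = 1 ∨ a % 4 = 3 by omega) with h1 | h3
    · exact Or.inl (by simpa using cast h1)
    · exact Or.inr (by simpa using cast h3)
  have hy : (b : ZMod 4) = 1 ∨ (b : ZMod 4) = 3 := by
    rcases (show b % 4 = 1 ∨ b % 4 = 3 by omega) with h1 | h3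
    · exact Or.inl (by simpa using cast h1)
    · exact Or.inr (by simpa using cast h3)
  have h3A : (cA6 : ZMod 4) = 3 := by simpa using cast hcA6
  have h36 : (c6 : ZMod 4) = 3 := by simpa using cast hc6
  have h3m : (m : ZMod 4) = 3 := by simpa using cast hm
  have e := congrArg (Int.cast : ℤ → ZMod 4) h
  push_cast at e
  rw [h3A, h36, h3m] at e
  exact key _ _ hx hy e

/-- **The `2`-adic case in integers.** There are no integers `cA4, c4` odd, `cA6 ≡ c6 ≡ −1 (mod 4)`,
`m ≡ 2, 3 (mod 4)` and coprime `a, b` with `cA4 · a⁴ = (4m)² · c4 · b⁴` and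
`cA6 · a⁶ = (4m)³ · c6 · b⁶` (the covariants of two `2`-minimal equations with `a₁` odd differing
by the twist by `4m` and the scaling `u = a/b`): `a = 2a₁`, `b` odd; `m ≡ 2`: parity; `m ≡ 3`:
`a₁` odd and `cA6 a₁⁶ = m³ c6 b⁶` is `3 ≡ 1 (mod 4)`. [folklore] -/
private theorem int_two_core {cA4 c4 cA6 c6 a b m : ℤ} (hcA4 : Odd cA4) (hc4 : Odd c4)
    (hcA6 : cA6 % 4 = 3) (hc6 : c6 % 4 = 3) (hm : m % 4 = 2 ∨ m % 4 = 3) (hab : IsCoprime a b)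
    (h4 : cA4 * a ^ 4 = (4 * m) ^ 2 * c4 * b ^ 4)
    (h6 : cA6 * a ^ 6 = (4 * m) ^ 3 * c6 * b ^ 6) : False := by
  have h2u : ¬ IsUnit (2 : ℤ) := by rw [Int.isUnit_iff]; omega
  -- `a` is even
  have ha : (2 : ℤ) ∣ a := by
    by_contra ha
    have hodd : Odd (cA4 * a ^ 4) := hcA4.mul (odd_of_not_two_dvd ha).pow
    have heven : Even ((4 * m) ^ 2 * c4 * b ^ 4) := ⟨8 * m ^ 2 * c4 * b ^ 4, by ring⟩
    rw [← h4] at heven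
    exact (Int.not_even_iff_odd.mpr hodd) heven
  obtain ⟨a₁, rfl⟩ := ha
  -- `b` is odd
  have hb : Odd b := odd_of_not_two_dvd fun hb ↦ h2u (hab.isUnit_of_dvd' (dvd_mul_right 2 a₁) hb)
  -- cancel the powers of `2`
  have h4' : cA4 * a₁ ^ 4 = m ^ 2 * c4 * b ^ 4 := by
    have : (16 : ℤ) * (cA4 * a₁ ^ 4) = 16 * (m ^ 2 * c4 * b ^ 4) := by linear_combination h4
    exact mul_left_cancel₀ (by norm_num) this
  have h6' : cA6 * a₁ ^ 6 = m ^ 3 * c6 * b ^ 6 := by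
    have : (64 : ℤ) * (cA6 * a₁ ^ 6) = 64 * (m ^ 3 * c6 * b ^ 6) := by linear_combination h6
    exact mul_left_cancel₀ (by norm_num) this
  rcases hm with hm | hm
  · -- `m = 2 m₁`, `m₁` odd: `cA4 a₁⁴ = 4 m₁² c4 b⁴` forces `a₁ = 2 a₂`, then `4 cA4 a₂⁴ = m₁² c4 b⁴` is odd
    obtain ⟨m₁, rfl⟩ : (2 : ℤ) ∣ m := Int.dvd_of_emod_eq_zero (by omega)
    have hm₁ : Odd m₁ := Int.odd_iff.mpr (by omega)
    have ha₁ : (2 : ℤ) ∣ a₁ := by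
      by_contra ha₁
      have hodd : Odd (cA4 * a₁ ^ 4) := hcA4.mul (odd_of_not_two_dvd ha₁).pow
      have heven : Even ((2 * m₁) ^ 2 * c4 * b ^ 4) := ⟨2 * m₁ ^ 2 * c4 * b ^ 4, by ring⟩
      rw [← h4'] at heven
      exact (Int.not_even_iff_odd.mpr hodd) heven
    obtain ⟨a₂, rfl⟩ := ha₁
    have h4'' : 4 * (cA4 * a₂ ^ 4) = m₁ ^ 2 * c4 * b ^ 4 := by
      have : (4 : ℤ) * (4 * (cA4 * a₂ ^ 4)) = 4 * (m₁ ^ 2 * c4 * b ^ 4) := by linear_combination h4'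
      exact mul_left_cancel₀ (by norm_num) this
    have hodd : Odd (m₁ ^ 2 * c4 * b ^ 4) := (hm₁.pow.mul hc4).mul hb.pow
    have heven : Even (4 * (cA4 * a₂ ^ 4)) := ⟨2 * (cA4 * a₂ ^ 4), by ring⟩
    rw [h4''] at heven
    exact (Int.not_even_iff_odd.mpr hodd) heven
  · -- `m ≡ 3 (mod 4)`: `a₁` is odd and `cA6 a₁⁶ = m³ c6 b⁶` is impossible modulo `4`
    have hmo : Odd m := Int.odd_iff.mpr (by omega)
    have ha₁ : Odd a₁ := by
      have hodd : Odd (cA4 * a₁ ^ 4) := by rw [h4']; exact (hmo.pow.mul hc4).mul hb.pow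
      exact (Int.odd_pow' (by norm_num)).mp (Int.odd_mul.mp hodd).2
    exact int_mod_four_core (Int.odd_iff.mp ha₁) (Int.odd_iff.mp hb) hcA6 hc6 hm h6'

/-- **The odd case in integers.** There are no integers `cA4, c4` prime to the prime `ℓ`, coprime
`a, b` and `D` with `ℓ ∥ D` such that `cA4 · a⁴ = D² · c4 · b⁴`: `ℓ ∣ a`, `ℓ ∤ b`, and cancelling
`ℓ²` leaves `ℓ² · cA4 · a₁⁴ = D₁² · c4 · b⁴` with `ℓ ∤ D₁ c4 b`. [folklore] -/
private theorem int_odd_core {ℓ : ℕ} (hℓ : ℓ.Prime) {cA4 c4 a b D : ℤ} (hcA4 : ¬ (ℓ : ℤ) ∣ cA4)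
    (hc4 : ¬ (ℓ : ℤ) ∣ c4) (hab : IsCoprime a b) (hD1 : (ℓ : ℤ) ∣ D) (hD2 : ¬ (ℓ : ℤ) ^ 2 ∣ D)
    (h4 : cA4 * a ^ 4 = D ^ 2 * c4 * b ^ 4) : False := by
  have hp : Prime (ℓ : ℤ) := Nat.prime_iff_prime_int.mp hℓ
  have hℓ0 : (ℓ : ℤ) ≠ 0 := hp.ne_zero
  have ha : (ℓ : ℤ) ∣ a := by
    have h1 : (ℓ : ℤ) ∣ cA4 * a ^ 4 := by
      rw [h4]
      exact ((dvd_pow hD1 two_ne_zero).mul_right c4).mul_right (b ^ 4)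
    rcases hp.dvd_or_dvd h1 with h | h
    · exact absurd h hcA4
    · exact hp.dvd_of_dvd_pow h
  have hb : ¬ (ℓ : ℤ) ∣ b := fun hb ↦ hp.not_unit (hab.isUnit_of_dvd' ha hb)
  obtain ⟨a₁, rfl⟩ := ha
  obtain ⟨D₁, rfl⟩ := hD1
  have hD₁ : ¬ (ℓ : ℤ) ∣ D₁ := fun ⟨e, he⟩ ↦ hD2 ⟨e, by rw [he]; ring⟩
  have h' : (ℓ : ℤ) ^ 2 * (cA4 * a₁ ^ 4) = D₁ ^ 2 * c4 * b ^ 4 := by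
    have : (ℓ : ℤ) ^ 2 * ((ℓ : ℤ) ^ 2 * (cA4 * a₁ ^ 4)) = (ℓ : ℤ) ^ 2 * (D₁ ^ 2 * c4 * b ^ 4) := by
      linear_combination h4
    exact mul_left_cancel₀ (pow_ne_zero 2 hℓ0) this
  have h2 : (ℓ : ℤ) ∣ D₁ ^ 2 * c4 * b ^ 4 := by
    rw [← h']
    exact dvd_mul_of_dvd_left (dvd_pow_self _ two_ne_zero) _
  rcases hp.dvd_or_dvd h2 with h | h
  · rcases hp.dvd_or_dvd h with h | h
    · exact hD₁ (hp.dvd_of_dvd_pow h)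
    · exact hc4 h
  · exact hb (hp.dvd_of_dvd_pow h)

/-! ### §2 The twist by a field discriminant: not both curves are multiplicative at a ramified prime -/

/-- At the place `v` of `ℚ` over `ℓ`, an integer of `v`-adic valuation `1` is prime to `ℓ`
(the converse of the tree's `valuation_ringOfIntegers_intCast_eq_one`). [folklore] -/
theorem not_dvd_of_valuation_intCast_eq_one (v : HeightOneSpectrum (𝓞 ℚ)) {n : ℤ}
    (h : v.valuation ℚ (n : ℚ) = 1) : ¬ ((primesEquiv v : ℕ) : ℤ) ∣ n := by
  haveI := Fact.mk (primesEquiv v).2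
  rwa [(valuation_equiv_padicValuation v).eq_one_iff_eq_one, Rat.padicValuation_cast,
    Int.padicValuation_eq_one_iff] at h

/-- **`c₄` of the minimal equation is an `ℓ`-unit at a multiplicative prime `ℓ`**: for `W / ℚ`
globally minimal with multiplicative reduction at `ℓ`, `ℓ ∤ c₄(W)` (Silverman, *AEC* VII.5
Prop. 5.1(b), through the place-indexed criterion `hasMultiplicativeReductionAt_iff_of_isMinimalAt`
and the bridge `hasMultiplicativeReductionAtPrime_iff_hasMultiplicativeReductionAt_ringOfIntegers`).
[cite: SilvermanAEC2009, VII.5 Prop. 5.1(b)] -/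
theorem not_dvd_c₄_integralModelInt_of_hasMultiplicativeReductionAtPrime (W : WeierstrassCurve ℚ)
    [W.IsElliptic] [W.IsGloballyMinimal] (ℓ : ℕ) [Fact ℓ.Prime]
    (hm : W.HasMultiplicativeReductionAtPrime ℓ) : ¬ (ℓ : ℤ) ∣ (integralModelInt W).c₄ := by
  have hℓ : ℓ.Prime := Fact.out
  set v : HeightOneSpectrum (𝓞 ℚ) := (primesEquiv (R := 𝓞 ℚ)).symm ⟨ℓ, hℓ⟩ with hv
  have hpv : primesEquiv v = ⟨ℓ, hℓ⟩ := (primesEquiv (R := 𝓞 ℚ)).apply_symm_apply _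
  have hm' : W.HasMultiplicativeReductionAt v := by
    have h := W.hasMultiplicativeReductionAtPrime_iff_hasMultiplicativeReductionAt_ringOfIntegers v
    rw [hpv] at h
    exact h.mp hm
  have hWM : (integralModelInt W).map (Int.castRingHom ℚ) = W := map_integralModelInt W
  have hWc₄ : W.c₄ = ((integralModelInt W).c₄ : ℚ) := by
    conv_lhs => rw [← hWM]
    rw [map_c₄, eq_intCast]
  have h := ((hasMultiplicativeReductionAt_iff_of_isMinimalAt
    (IsGloballyMinimal.isMinimal (W := W) v)).mp hm').2
  rw [hWc₄] at h
  have h' := not_dvd_of_valuation_intCast_eq_one v h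
  rwa [hpv] at h'

/-- **Two globally minimal curves differing by the twist by a field discriminant `d_K` are not both
multiplicative at a prime `ℓ ∣ d_K`** — equivalently: the twist of a curve with multiplicative
reduction at `ℓ` by a quadratic character RAMIFIED at `ℓ` does not have multiplicative (hence has
additive) reduction at `ℓ` (Silverman, *AEC* VII.5 Prop. 5.1 with X.5 Cor. 5.4; at `ℓ = 2` the
tree's Kraus-parity facts `odd_a₁_of_hasMultiplicativeReductionAtPrime_two`, `odd_c₄_of_odd_a₁`,
`exists_c₆_eq_of_odd_a₁`). For `W, A / ℚ` globally minimal, `K` quadratic, `A = C • W^{(d_K)}`: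
the covariants satisfy `c₄(A) u⁴ = d_K² c₄(W)`, `c₆(A) u⁶ = d_K³ c₆(W)` (`u = C.u`); if both curves
were multiplicative at `ℓ ∣ d_K` then both `c₄` are `ℓ`-units, so `ord_ℓ d_K` is even, contradicting
`ℓ ∥ d_K` for odd `ℓ` (`not_sq_dvd_discr_of_prime_ne_two`) and `d_K = 8m'` at `ℓ = 2`; and for
`d_K = 4m`, `m ≡ 3 (mod 4)` (`discr_div_four_emod_four`) both `c₆ ≡ −1 (mod 4)` give
`−1 ≡ −m³ (mod 4)`, absurd (`int_two_core`). [cite: SilvermanAEC2009, VII.5 Prop. 5.1 and X.5 Cor. 5.4]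
[cite: Marcus2018, Ch. 2 Thm. 1] -/
theorem not_hasMultiplicativeReductionAtPrime_of_smul_quadraticTwist_discr
    (W A : WeierstrassCurve ℚ) [W.IsElliptic] [W.IsGloballyMinimal] [A.IsElliptic] [A.IsGloballyMinimal]
    (K : Type) [Field K] [NumberField K] (hK2 : Module.finrank ℚ K = 2)
    (C : VariableChange ℚ) (hA : C • W.quadraticTwist (NumberField.discr K : ℚ) = A)
    (ℓ : ℕ) [Fact ℓ.Prime] (hℓD : (ℓ : ℤ) ∣ NumberField.discr K)
    (hAm : A.HasMultiplicativeReductionAtPrime ℓ) : ¬ W.HasMultiplicativeReductionAtPrime ℓ := by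
  intro hWm
  have hℓ : ℓ.Prime := Fact.out
  set D : ℤ := NumberField.discr K with hD
  have hD0 : (D : ℚ) ≠ 0 := by rw [hD]; exact_mod_cast NumberField.discr_ne_zero K
  haveI : (W.quadraticTwist (D : ℚ)).IsElliptic := W.isElliptic_quadraticTwist hD0
  -- the integer models and their covariants
  set M : WeierstrassCurve ℤ := integralModelInt W with hM
  set MA : WeierstrassCurve ℤ := integralModelInt A with hMA
  have hWM : M.map (Int.castRingHom ℚ) = W := map_integralModelInt W
  have hAM : MA.map (Int.castRingHom ℚ) = A := map_integralModelInt A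
  have hWc₄ : W.c₄ = (M.c₄ : ℚ) := by conv_lhs => rw [← hWM]; rw [map_c₄, eq_intCast]
  have hWc₆ : W.c₆ = (M.c₆ : ℚ) := by conv_lhs => rw [← hWM]; rw [map_c₆, eq_intCast]
  have hAc₄ : A.c₄ = (MA.c₄ : ℚ) := by conv_lhs => rw [← hAM]; rw [map_c₄, eq_intCast]
  have hAc₆ : A.c₆ = (MA.c₆ : ℚ) := by conv_lhs => rw [← hAM]; rw [map_c₆, eq_intCast]
  -- `c₄(A) u⁴ = D² c₄(W)`, `c₆(A) u⁶ = D³ c₆(W)`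
  set u : ℚ := (C.u : ℚ) with hu_def
  have hu0 : u ≠ 0 := C.u.ne_zero
  have E4Q : (MA.c₄ : ℚ) * u ^ 4 = (D : ℚ) ^ 2 * (M.c₄ : ℚ) := by
    have h := congrArg WeierstrassCurve.c₄ hA
    rw [variableChange_c₄, quadraticTwist_c₄, hWc₄, hAc₄, Units.val_inv_eq_inv_val, ← hu_def] at h
    rw [← h]
    field_simp
  have E6Q : (MA.c₆ : ℚ) * u ^ 6 = (D : ℚ) ^ 3 * (M.c₆ : ℚ) := by
    have h := congrArg WeierstrassCurve.c₆ hA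
    rw [variableChange_c₆, quadraticTwist_c₆, hWc₆, hAc₆, Units.val_inv_eq_inv_val, ← hu_def] at h
    rw [← h]
    field_simp
  -- `u = a / b` in lowest terms
  obtain ⟨a, b, hab, hu⟩ : ∃ a b : ℤ, IsCoprime a b ∧ (a : ℚ) = u * b := by
    refine ⟨u.num, u.den, ?_, ?_⟩
    · rw [Int.isCoprime_iff_gcd_eq_one]
      show u.num.natAbs.gcd u.den = 1
      exact u.reduced
    · push_cast
      exact (Rat.mul_den_eq_num u).symm
  have E4Z : MA.c₄ * a ^ 4 = D ^ 2 * M.c₄ * b ^ 4 := by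
    have h : (MA.c₄ : ℚ) * (a : ℚ) ^ 4 = (D : ℚ) ^ 2 * (M.c₄ : ℚ) * (b : ℚ) ^ 4 := by
      rw [hu, mul_pow, ← mul_assoc, E4Q]
    exact_mod_cast h
  have E6Z : MA.c₆ * a ^ 6 = D ^ 3 * M.c₆ * b ^ 6 := by
    have h : (MA.c₆ : ℚ) * (a : ℚ) ^ 6 = (D : ℚ) ^ 3 * (M.c₆ : ℚ) * (b : ℚ) ^ 6 := by
      rw [hu, mul_pow, ← mul_assoc, E6Q]
    exact_mod_cast h
  -- both `c₄` are `ℓ`-units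
  have hc4 : ¬ (ℓ : ℤ) ∣ M.c₄ :=
    not_dvd_c₄_integralModelInt_of_hasMultiplicativeReductionAtPrime W ℓ hWm
  have hcA4 : ¬ (ℓ : ℤ) ∣ MA.c₄ :=
    not_dvd_c₄_integralModelInt_of_hasMultiplicativeReductionAtPrime A ℓ hAm
  by_cases hℓ2 : ℓ = 2
  · -- `ℓ = 2`: `D = 4m`, `m ≡ 2, 3 (mod 4)`; `a₁` odd for both minimal equations
    subst hℓ2
    have hD4 : (4 : ℤ) ∣ D := by
      rcases Literature.NumberTheory.QuadraticFields.Quadratic.discr_emod_four (K := K) hK2 with h | h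
      · exact Int.dvd_of_emod_eq_zero h
      · exfalso; omega
    have hm := Literature.NumberTheory.QuadraticFields.Quadratic.discr_div_four_emod_four (K := K) hK2 hD4
    have hDm : D = 4 * (D / 4) := by omega
    have ha₁W := odd_a₁_of_hasMultiplicativeReductionAtPrime_two W hWm
    have ha₁A := odd_a₁_of_hasMultiplicativeReductionAtPrime_two A hAm
    obtain ⟨k, hk⟩ := exists_c₆_eq_of_odd_a₁ M ha₁W
    obtain ⟨k', hk'⟩ := exists_c₆_eq_of_odd_a₁ MA ha₁A
    refine int_two_core (m := D / 4) (odd_of_not_two_dvd (by exact_mod_cast hcA4))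
      (odd_of_not_two_dvd (by exact_mod_cast hc4)) (cA6 := MA.c₆) (c6 := M.c₆) (by omega) (by omega)
      hm hab ?_ ?_
    · rw [← hDm]; exact E4Z
    · rw [← hDm]; exact E6Z
  · -- odd `ℓ ∥ D`
    exact int_odd_core hℓ hcA4 hc4 hab hℓD
      (Literature.NumberTheory.QuadraticFields.Quadratic.not_sq_dvd_discr_of_prime_ne_two hK2 hℓ hℓ2)
      E4Z

end Summit.BirchSwinnertonDyer.BirchSwinnertonDyer.Theorems.GenusStringentRoadK

end
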